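import Summits.ResolutionOfSingularities.ResolutionOfSingularities.Theorems.MarkedTransferCampaignW21LucasBound
import HarnessLib

/-!
# [OURS · L1 W2.1] The Case-(I) order bound on the EXACT CLASS: `OrderBoundExactPos p` — PROVED for every prime `p`

Rung L (rescue) of cell res-hironaka, RESCUE-SEED row L-G2, slot W2.1, seat res-L1-s21-pv-1. Vocabulary:
`MarkedTransferCampaignW21OrderBoundInClass.lean` (res-L1-type-o3; `ExactClass`, `DigitLE`) and its ERRATUM companion
`MarkedTransferCampaignW21OrderBoundPos.lean` (p469452; `OrderBoundExactPos p := OrderBoundOnPos p ExactClass`, `e > 0`).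
`ExactClass` is the widest slice of the vocabulary (⊇ `LucasClass` ⊇ `MinDegreeTop`): «for every top-block index `j` and
every effective term `t = (a,b,c)` with `γ₀ ≼_p c` digitwise, `ord ε + q|γ₀| ≤ q|γ_j| + |a + pb + qc|`» — the class the
kill test K2.1 (res-L1-k21) names at `p = q = 2` (`C_*`).

THIS FILE PROVES `orderBoundExactPos_holds : ∀ p, OrderBoundExactPos p`. Beyond the Lucas bound of
`MarkedTransferCampaignW21LucasBound.lean` (first factor: `ord ∂^{(α+pβ)}ε ≥ q|γ_j|` for some `j`) it needs the sharper
bound for the SECOND factor: a term `u x^{a+pb+qc}` survives `∂^{(qγ₀)}` only if `p ∤ ∏_i C(a_i + p b_i + q c_i, q γ₀,i)`,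
and by the two-block form of Lucas' theorem (`choose_twoBlock_modEq`: `C(A + p^e c, B + p^e g) ≡ C(A,B)·C(c,g) (mod p)`
for `A, B < p^e`) and the digit criterion (`digitLE_of_not_dvd_choose`: `p ∤ C(c,g) ⇒ g ≼_p c`, N. J. Fine 1947 Thm 2)
this forces `γ₀ ≼_p c` coordinatewise (`digitLE_of_hasseDeriv_monomial_ne_zero`, needs `0 < e` so that
`a_i + p b_i < p^e`); the survivor has order `≥ |a+pb+qc| − q|γ₀|`, which `ExactClass` bounds below by `ord ε − q|γ_j|`.
Everything here is OURS / folklore; nothing is a statement of or about the manuscript under adjudication (GAP row R05);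
AI-produced formalisation, expert review is stronger than AI review.

## References
* N. J. Fine, *Binomial coefficients modulo a prime*, Amer. Math. Monthly 54 (1947) 589–592, Thms 1–2 [Fine1947].
* Mathlib `Choose.choose_modEq_choose_mod_mul_choose_div_nat` (one Lucas step).
-/

noncomputable section

set_option linter.dupNamespace false -- mandated namespace of this single-conjunct summit

namespace Summit.ResolutionOfSingularities.ResolutionOfSingularities.Theorems

namespace CampaignW21

open Literature.AlgebraicGeometry.Hironaka2017.S08UnitMonomial
open Literature.AlgebraicGeometry.Hironaka2017.S09LLUED
open Literature.AlgebraicGeometry.Hironaka2017.S09LLUED.TopFrontier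
open Literature.AlgebraicGeometry.Resolution
open Literature.RingTheory.MvPowerSeries
open MvPowerSeries Finsupp

/-! ## 1. Arithmetic: two-block Lucas, digit criterion, digit ranges -/

section Arithmetic

variable {p : ℕ} [hp : Fact p.Prime]

/-- **Two-block Lucas congruence**: for `A, B < p^e`, `C(A + p^e c, B + p^e g) ≡ C(A, B) · C(c, g) (mod p)` (iterate the
one-step congruence `C(n,k) ≡ C(n mod p, k mod p) C(n/p, k/p)`). [cite: Fine1947, Thm 1] -/
theorem choose_twoBlock_modEq :
    ∀ (e : ℕ) {A B : ℕ} (c g : ℕ), A < p ^ e → B < p ^ e →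
      (A + p ^ e * c).choose (B + p ^ e * g) ≡ A.choose B * c.choose g [MOD p]
  | 0, A, B, c, g, hA, hB => by
    have hA0 : A = 0 := by simpa using hA
    have hB0 : B = 0 := by simpa using hB
    subst hA0; subst hB0
    simp [Nat.ModEq.refl]
  | e + 1, A, B, c, g, hA, hB => by
    have hp0 : 0 < p := hp.out.pos
    have h1 := Choose.choose_modEq_choose_mod_mul_choose_div_nat (n := A + p ^ (e + 1) * c)
      (k := B + p ^ (e + 1) * g) (p := p)
    have h2 := Choose.choose_modEq_choose_mod_mul_choose_div_nat (n := A) (k := B) (p := p)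
    have hmodA : (A + p ^ (e + 1) * c) % p = A % p := by rw [pow_succ', mul_assoc, Nat.add_mul_mod_self_left]
    have hdivA : (A + p ^ (e + 1) * c) / p = A / p + p ^ e * c := by
      rw [pow_succ', mul_assoc, Nat.add_mul_div_left _ _ hp0]
    have hmodB : (B + p ^ (e + 1) * g) % p = B % p := by rw [pow_succ', mul_assoc, Nat.add_mul_mod_self_left]
    have hdivB : (B + p ^ (e + 1) * g) / p = B / p + p ^ e * g := by
      rw [pow_succ', mul_assoc, Nat.add_mul_div_left _ _ hp0]
    have hA' : A / p < p ^ e := by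
      rw [Nat.div_lt_iff_lt_mul hp0]; simpa [pow_succ] using hA
    have hB' : B / p < p ^ e := by
      rw [Nat.div_lt_iff_lt_mul hp0]; simpa [pow_succ] using hB
    have ih := choose_twoBlock_modEq e c g hA' hB'
    rw [hmodA, hdivA, hmodB, hdivB] at h1
    calc (A + p ^ (e + 1) * c).choose (B + p ^ (e + 1) * g)
        ≡ (A % p).choose (B % p) * ((A / p).choose (B / p) * c.choose g) [MOD p] := h1.trans (ih.mul_left _)
      _ = (A % p).choose (B % p) * (A / p).choose (B / p) * c.choose g := by rw [mul_assoc]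
      _ ≡ A.choose B * c.choose g [MOD p] := h2.symm.mul_right _

/-- **Digit criterion** (Fine): `p ∤ C(c, g)` forces every base-`p` digit of `g` to be `≤` the corresponding digit of `c`,
i.e. `DigitLE p g c`. [cite: Fine1947, Thm 2] -/
theorem digitLE_of_not_dvd_choose : ∀ (d : ℕ) {c g : ℕ}, ¬ p ∣ c.choose g → g / p ^ d % p ≤ c / p ^ d % p
  | 0, c, g, h => by
    rw [pow_zero, Nat.div_one, Nat.div_one]
    exact Nat.le_of_not_dvd_choose (Nat.not_dvd_choose_mod_and_div_of_not_dvd_choose h).1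
  | d + 1, c, g, h => by
    have ih := digitLE_of_not_dvd_choose d (Nat.not_dvd_choose_mod_and_div_of_not_dvd_choose h).2
    rw [pow_succ', ← Nat.div_div_eq_div_mul, ← Nat.div_div_eq_div_mul]
    exact ih

omit hp in
/-- The mixed-radix lower block: `a + p·b < p^e` for `a < p`, `b < p^{e−1}`, `0 < e`. [folklore] -/
theorem add_mul_lt_pow {e a b : ℕ} (he : 0 < e) (ha : a < p) (hb : b < p ^ (e - 1)) : a + p * b < p ^ e := by
  have h1 : p * (b + 1) ≤ p * p ^ (e - 1) := Nat.mul_le_mul_left _ hb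
  have h2 : p * p ^ (e - 1) = p ^ e := by
    rw [← pow_succ']; congr 1; omega
  rw [mul_add, mul_one, h2] at h1
  omega

end Arithmetic

/-! ## 2. Lucas selection for the second factor `∂^{(qγ₀)}` -/

section SecondFactor

variable (p : ℕ) [hp : Fact p.Prime] {K : Type} [Field K] [CharP K p] {n e ℓ : ℕ}

/-- **The survivors of `∂^{(qγ)}` are the terms whose `c` dominates `γ` DIGITWISE**: in characteristic `p`, with
`a_i < p`, `b_i < p^{e−1}`, `0 < e`, if `Δ_{p^e•γ} (coef · X^{a + p•b + p^e•c}) ≠ 0` then `γ_i ≼_p c_i` for every `i`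
(`DigitLE`). [cite: Fine1947, Thm 2] -/
theorem digitLE_of_hasseDeriv_monomial_ne_zero (he : 0 < e) {a b c γ : Fin n →₀ ℕ} (ha : ∀ i, a i < p)
    (hb : ∀ i, b i < p ^ (e - 1)) (coef : K)
    (h : hasseDeriv (p ^ e • γ) (monomial (a + p • b + p ^ e • c) coef) ≠ 0) :
    ∀ i, DigitLE p (γ i) (c i) := by
  classical
  by_cases hle : p ^ e • γ ≤ a + p • b + p ^ e • c
  · obtain ⟨d, hd⟩ := exists_add_of_le hle
    rw [hd, hasseDeriv_monomial_add'] at h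
    have hC : ¬ p ∣ ((p ^ e • γ + d).prod fun s k => k.choose ((p ^ e • γ) s)) := by
      intro hdvd; apply h
      rw [(CharP.cast_eq_zero_iff K p _).mpr hdvd, zero_mul, map_zero]
    rw [prod_choose_eq] at hC
    intro i
    have hndvd : ¬ p ∣ ((p ^ e • γ) i + d i).choose ((p ^ e • γ) i) := fun hdiv =>
      hC (dvd_trans hdiv (Finset.dvd_prod_of_mem (fun s => ((p ^ e • γ) s + d s).choose ((p ^ e • γ) s))
        (Finset.mem_univ i)))
    have hmi : (p ^ e • γ) i + d i = (a i + p * b i) + p ^ e * c i := by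
      have := DFunLike.congr_fun hd i
      simp only [Finsupp.add_apply, Finsupp.smul_apply, smul_eq_mul] at this ⊢
      omega
    have hθi : (p ^ e • γ) i = 0 + p ^ e * γ i := by simp only [Finsupp.smul_apply, smul_eq_mul, zero_add]
    rw [hmi, hθi] at hndvd
    have hmod := choose_twoBlock_modEq (p := p) e (c i) (γ i) (add_mul_lt_pow he (ha i) (hb i))
      (Nat.pow_pos hp.out.pos)
    rw [Nat.choose_zero_right, one_mul] at hmod
    have hcg : ¬ p ∣ (c i).choose (γ i) := fun hdiv => hndvd ((hmod.dvd_iff dvd_rfl).mpr hdiv)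
    exact fun dd => digitLE_of_not_dvd_choose dd hcg
  · exact absurd (hasseDeriv_monomial_of_not_le' hle coef) h

/-- **Order of the second factor**: if every effective term `t` with `γ₀ ≼_p c_t` digitwise and `qγ₀ ≤ a+pb+qc` has
`N + q|γ₀| ≤ |a + pb + qc|`, then `N ≤ ord ∂^{(qγ₀)} ε` (standard expression with `0 < e`, all coordinates of `qγ₀`
`< p^ℓ`). [folklore] -/
theorem le_order_hasseDeriv_qgamma (he : 0 < e) {ε : MvPowerSeries (Fin n) K}
    (S : StandardExpression p (xs K n) e ℓ ε) (γ₀ : Fin n →₀ ℕ) (hX : ∀ s, (p ^ e • γ₀) s < p ^ ℓ) (N : ℕ)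
    (hadm : ∀ t ∈ effSupport S.support S.u, (∀ i, DigitLE p (γ₀ i) (t.2.2 i)) →
      p ^ e • γ₀ ≤ t.1 + p • t.2.1 + p ^ e • t.2.2 →
        N + p ^ e * γ₀.degree ≤ (t.1 + p • t.2.1 + p ^ e • t.2.2).degree) :
    (N : ℕ∞) ≤ (hasseDeriv (p ^ e • γ₀) ε).order := by
  classical
  have key := hasseDeriv_sum_terms p (e := e) S.support S.u S.u_mem hX
  rw [← S.sum_eq] at key
  rw [key]
  apply le_order_finsetSum
  intro t ht
  by_cases hu : S.u t = 0
  · rw [hu, zero_mul, order_zero]; exact le_top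
  by_cases hD : hasseDeriv (p ^ e • γ₀) (monomial (t.1 + p • t.2.1 + p ^ e • t.2.2) (1 : K)) = 0
  · rw [hD, mul_zero, order_zero]; exact le_top
  have hte : t ∈ effSupport S.support S.u := (mem_effSupport S.support S.u).2 ⟨ht, hu⟩
  have hdig := digitLE_of_hasseDeriv_monomial_ne_zero p he (S.a_lt t ht) (S.b_lt t ht) (1 : K) hD
  by_cases hle : p ^ e • γ₀ ≤ t.1 + p • t.2.1 + p ^ e • t.2.2
  · have hN := hadm t hte hdig hle
    obtain ⟨d, hd⟩ := exists_add_of_le hle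
    rw [hd, hasseDeriv_monomial_add']
    rw [hd, map_add, map_nsmul, smul_eq_mul] at hN
    calc (N : ℕ∞) ≤ (d.degree : ℕ∞) := by exact_mod_cast (by omega : N ≤ d.degree)
      _ ≤ _ := degree_le_order_mul_monomial _ _ _
  · exact absurd (hasseDeriv_monomial_of_not_le' hle (1 : K)) hD

end SecondFactor

/-! ## 3. Assembly and the theorem -/

/-- Assembly of the Case-(I) value: a lower bound for `ord ∂^{(α+pβ)}ε + ord ∂^{(qγ₀)}ε` bounds `ord H♭(ε)` below
(`ord(u₀⁻¹ · A · B) ≥ ord A + ord B`). [folklore] -/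
theorem le_adicOrder_caseI_of_le {K : Type} [Field K] {n : ℕ} (u : (MvPowerSeries (Fin n) K)ˣ) (p q : ℕ)
    (α β γ₀ : Fin n →₀ ℕ) (ε : MvPowerSeries (Fin n) K) {m : ℕ∞}
    (h : m ≤ (hasseDeriv (α + p • β) ε).order + (hasseDeriv (q • γ₀) ε).order) :
    m ≤ adicOrder (HFlat.caseI (hasseD K n) u p q α β γ₀ ε) := by
  show m ≤ adicOrder ((↑u⁻¹ : MvPowerSeries (Fin n) K) * hasseD K n (α + p • β) ε * hasseD K n (q • γ₀) ε)
  have hunit : adicOrder ((↑u⁻¹ : MvPowerSeries (Fin n) K)) = 0 := adicOrder_of_isUnit (Units.isUnit _)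
  have hprod := adicOrder_add_adicOrder_le_mul (↑u⁻¹ : MvPowerSeries (Fin n) K)
    (hasseD K n (α + p • β) ε * hasseD K n (q • γ₀) ε)
  rw [hunit, zero_add, ← mul_assoc] at hprod
  refine le_trans ?_ hprod
  rw [adicOrder_eq_order (hasseD K n (α + p • β) ε * hasseD K n (q • γ₀) ε)]
  exact h.trans MvPowerSeries.le_order_mul

/-- **[OURS · L1 W2.1] `OrderBoundExactPos p` HOLDS for every prime `p`**: the Case-(I) order bound `ord ε ≤ ord H♭(ε)`
on the EXACT CLASS of standard-expression data in `K⟦x⟧` (`q = p^e`, `e > 0`) — the widest slice of the W2.1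
vocabulary, the class kill test K2.1 names (`C_*` at `p = q = 2`). Neither the Case-(I) inequality nor `K` perfect is
used. Replaces the role of Rem. 9.9 (1) / Def. 9.12's order clause (p.51 L5–L6, L30–L32) ON THAT CLASS; NOT a statement
of the manuscript; says nothing about the unrestricted claim (GAP row R05). [folklore] -/
theorem orderBoundExactPos_holds (p : ℕ) [Fact p.Prime] : OrderBoundExactPos p := by
  intro K _ _ n e ℓ he ε S h0 hS _hI hC
  have hX : ∀ s, (alpha S.support S.u + p • beta S.support S.u) s < p ^ ℓ := fun s =>
    lt_of_le_of_lt ((Finsupp.le_degree s _).trans (Finsupp.degree_mono le_self_add)) hS.depth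
  have hXq : ∀ s, (p ^ e • gamma S.support S.u ⟨0, h0⟩) s < p ^ ℓ := fun s =>
    lt_of_le_of_lt ((Finsupp.le_degree s _).trans (Finsupp.degree_mono le_add_self)) hS.depth
  obtain ⟨j, hA⟩ := exists_gamma_le_order_hasseDeriv p he S h0 hX
  -- `ord ε` is finite: the top term `(α, β, γ₀)` is admissible in `ExactClass`
  have ht0 : (alpha S.support S.u, beta S.support S.u, gamma S.support S.u ⟨0, h0⟩) ∈ effSupport S.support S.u :=
    gamma_mem_effSupport ⟨0, h0⟩
  have hC0 := hC h0 j _ ht0 (fun i d => le_rfl)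
  have hfin : adicOrder ε ≠ ⊤ := by
    intro htop
    rw [htop, top_add] at hC0
    exact (not_le_of_gt (ENat.coe_lt_top _)) hC0
  obtain ⟨N, hN⟩ := ENat.ne_top_iff_exists.mp hfin
  -- the second factor
  have hB : ((N - p ^ e * (gamma S.support S.u j).degree : ℕ) : ℕ∞) ≤
      (hasseDeriv (p ^ e • gamma S.support S.u ⟨0, h0⟩) ε).order := by
    refine le_order_hasseDeriv_qgamma p he S (gamma S.support S.u ⟨0, h0⟩) hXq _ fun t ht hdig hle => ?_
    have h := hC h0 j t ht hdig
    rw [← hN, ← Nat.cast_add, Nat.cast_le] at h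
    have hle' : p ^ e * (gamma S.support S.u ⟨0, h0⟩).degree ≤ (t.1 + p • t.2.1 + p ^ e • t.2.2).degree := by
      have := Finsupp.degree_mono hle
      rwa [map_nsmul, smul_eq_mul] at this
    omega
  -- assemble
  rw [← hN]
  refine le_adicOrder_caseI_of_le _ p (p ^ e) _ _ _ ε ?_
  calc (N : ℕ∞)
      ≤ ((p ^ e * (gamma S.support S.u j).degree : ℕ) : ℕ∞) +
          ((N - p ^ e * (gamma S.support S.u j).degree : ℕ) : ℕ∞) := by
        rw [← Nat.cast_add, Nat.cast_le]; omega
    _ ≤ _ := add_le_add hA hB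

/-- **[OURS · L1 W2.1] `OrderBoundOnPos` is antitone in the class**: a bound on a wider class gives the bound on any
sub-class (pure logic; e.g. `ExactClass ⊇ LucasClass ⊇ MinDegreeTop` once the inclusions are proved). [folklore] -/
theorem orderBoundOnPos_mono (p : ℕ) [Fact p.Prime]
    {C D : ∀ {K : Type} [Field K] {n ℓ : ℕ} (p e : ℕ) (ε : MvPowerSeries (Fin n) K),
      StandardExpression p (xs K n) e ℓ ε → Prop}
    (hCD : ∀ {K : Type} [Field K] {n ℓ : ℕ} (p e : ℕ) (ε : MvPowerSeries (Fin n) K)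
      (S : StandardExpression p (xs K n) e ℓ ε), C p e ε S → D p e ε S)
    (hD : OrderBoundOnPos p D) : OrderBoundOnPos p C :=
  fun K _ _ n e ℓ he ε S h0 hS hI hC => hD K n e ℓ he ε S h0 hS hI (hCD p e ε S hC)

end CampaignW21

end Summit.ResolutionOfSingularities.ResolutionOfSingularities.Theorems

end
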